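import Literature.NumberTheory.LFunctions.Zhang2022.Section12Lemma121Ranges
import Literature.NumberTheory.LFunctions.Zhang2022.RepairGapSection12Line020Premise
import HarnessLib

/-!
# Zhang (2022), rescue GAP/BED (D-0124 (3)(4)): Lemma 12.1, range (ii) (`P″₁/T < d ≤ P″₁`) in the weak form the tree
# derives, under the minimum premise `‖L(1,χ)‖ ≤ 𝓛⁻¹⁵`

Topic `Literature/NumberTheory/LFunctions/Zhang2022` (Landau–Siegel audit tree; verdict-neutral).
Y. Zhang, *Discrete mean estimates and the Landau–Siegel zero*, arXiv:2211.02515v1 (2022)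
[Zhang2022LandauSiegel] — **an unrefereed manuscript under adjudication; nothing in this file asserts or
denies its Theorems 1–2, and nothing here is a claim about Landau–Siegel zeros. The programme SEARCHES and
TYPES; no claim about Landau–Siegel zeros, Theorems 1–2 of arXiv:2211.02515 or a repaired Margin232 until a
kernel theorem says so.**

The tree's `Section12Lemma121Ranges` derives the range-(ii) bound of Lemma 12.1 (`Typed.Sec12B.sum121_range_two_weak` /
`sum121_range_two_weak'`: `‖Σ_l χ(l)ϰ₁₃(dl)l^{β_j−1}‖ ≤ C(|L′(1,χ)| + 𝓛^{2.2})/𝓛⁹`, resp. `≤ C𝓛^{2.2}/𝓛⁹`) from the closed form of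
the first displayed line (`line020_closed_form`, a Lemma 8.2-core consumer) — Assumption (A) is only THREADED into that input,
which is kernel at exponent 15 (`Typed.Sec12B.line020_closed_form_pow15`, p590995). This file = the tree's sections
`RangeTwo` / `RangeTwoMain` VERBATIM (private helpers included) with the guard text swapped and the input re-pointed:
`sum121_range_two_weak_pow15`, `sum121_range_two_weak_pow15'`. Input of the low range `Low1522` of (12.16) at exponent 15
(`RepairGapSection12Low1522Premise`). Theorems only; no definition, no named fact; nothing about (A) itself.

## References

* Y. Zhang, arXiv:2211.02515v1 (2022), §12 Lemma 12.1, p. 68. [cite: Zhang2022LandauSiegel, §12 Lemma 12.1 p.68]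
-/

noncomputable section

open Complex Real ComplexConjugate

namespace Literature.NumberTheory.LFunctions.Zhang2022.Typed.Sec12B

open Literature.NumberTheory.LFunctions.Zhang2022.Skeleton

section RangeOneHelpers

/-- The shifts `β_j` (2.13) are purely imaginary of size `≤ (3 + 5|c′|)α` (any real `c′`; for
`𝓛 ≥ 2`). [cite: Zhang2022LandauSiegel, §2 (2.13)] -/
private theorem betaJ_re_and_norm' (c' : ℝ) {D : ℕ} (hL : 2 ≤ Real.log D) {j : ℕ}
    (hj : j ∈ ({1, 2, 3} : Finset ℕ)) :
    (betaJ c' D j).re = 0 ∧ ‖betaJ c' D j‖ ≤ (3 + 5 * |c'|) * (π / Real.log D ^ 9) := by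
  have hπ := Real.pi_pos
  have hL0 : 0 < Real.log D := by linarith
  have hα : alpha D = π / Real.log D ^ 9 := by rw [alpha, bigP, Real.log_exp, ell]
  set a : ℝ := π / Real.log D ^ 9 with ha
  have ha0 : 0 < a := by positivity
  have hell : ell D = Real.log D := rfl
  have haL : a * Real.log D ≤ 1 := by
    have h8 : (2 : ℝ) ^ 8 ≤ Real.log D ^ 8 := pow_le_pow_left₀ (by norm_num) hL 8
    have hπ4 : π ≤ 4 := Real.pi_le_four
    rw [ha, div_mul_eq_mul_div, div_le_one (by positivity)]
    calc π * Real.log D ≤ 4 * Real.log D := by nlinarith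
      _ ≤ 2 ^ 8 * Real.log D := by nlinarith
      _ ≤ Real.log D ^ 8 * Real.log D := by nlinarith
      _ = Real.log D ^ 9 := by ring
  have haL0 : 0 ≤ a * Real.log D := by positivity
  have hc0 : 0 ≤ |c'| := abs_nonneg _
  have hcaL : |c'| * (a * Real.log D) ≤ |c'| := by nlinarith
  simp only [Finset.mem_insert, Finset.mem_singleton] at hj
  rcases hj with rfl | rfl | rfl
  · have he : betaJ c' D 1 = ((a * (1 - 5 * c' * a * Real.log D) : ℝ) : ℂ) * I := by
      simp only [betaJ, Nat.reduceMod, if_true, beta1, hα, hell]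
      push_cast; ring
    refine ⟨by rw [he]; exact Lemma82.re_ofReal_mul_I _, ?_⟩
    rw [he, Lemma82.norm_ofReal_mul_I, abs_mul, abs_of_pos ha0]
    have h1 : |1 - 5 * c' * a * Real.log D| ≤ 1 + 5 * |c'| := by
      calc |1 - 5 * c' * a * Real.log D| ≤ |(1 : ℝ)| + |5 * c' * a * Real.log D| := abs_sub _ _
        _ = 1 + 5 * (|c'| * (a * Real.log D)) := by
            rw [abs_one, show 5 * c' * a * Real.log D = 5 * (c' * (a * Real.log D)) by ring,
              abs_mul, abs_mul, abs_of_nonneg haL0, abs_of_pos (by norm_num : (0 : ℝ) < 5)]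
        _ ≤ 1 + 5 * |c'| := by linarith
    nlinarith
  · have he : betaJ c' D 2 = ((2 * a * (1 + c' * a * Real.log D) : ℝ) : ℂ) * I := by
      simp only [betaJ, Nat.reduceMod, beta2, hα, hell]
      norm_num; ring
    refine ⟨by rw [he]; exact Lemma82.re_ofReal_mul_I _, ?_⟩
    rw [he, Lemma82.norm_ofReal_mul_I, abs_mul, abs_of_pos (by positivity : (0 : ℝ) < 2 * a)]
    have h1 : |1 + c' * a * Real.log D| ≤ 1 + |c'| := by
      calc |1 + c' * a * Real.log D| ≤ |(1 : ℝ)| + |c' * a * Real.log D| := abs_add_le _ _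
        _ = 1 + |c'| * (a * Real.log D) := by
            rw [abs_one, show c' * a * Real.log D = c' * (a * Real.log D) by ring, abs_mul,
              abs_of_nonneg haL0]
        _ ≤ 1 + |c'| := by linarith
    nlinarith
  · have he : betaJ c' D 3 = ((3 * a * (1 - c' * a * Real.log D) : ℝ) : ℂ) * I := by
      simp only [betaJ, Nat.reduceMod, beta3, hα, hell]
      norm_num; ring
    refine ⟨by rw [he]; exact Lemma82.re_ofReal_mul_I _, ?_⟩
    rw [he, Lemma82.norm_ofReal_mul_I, abs_mul, abs_of_pos (by positivity : (0 : ℝ) < 3 * a)]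
    have h1 : |1 - c' * a * Real.log D| ≤ 1 + |c'| := by
      calc |1 - c' * a * Real.log D| ≤ |(1 : ℝ)| + |c' * a * Real.log D| := abs_sub _ _
        _ = 1 + |c'| * (a * Real.log D) := by
            rw [abs_one, show c' * a * Real.log D = c' * (a * Real.log D) by ring, abs_mul,
              abs_of_nonneg haL0]
        _ ≤ 1 + |c'| := by linarith
    nlinarith

end RangeOneHelpers

section RangeTwo

variable (c' : ℝ) {D : ℕ} (χ : DirichletCharacter ℂ D)

/-- `z^{−b}/z^{1−a} = 1/z^{1+b−a}` for `z ≠ 0`. [folklore] -/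
private theorem cpow_neg_div_cpow_one_sub' {z : ℂ} (hz : z ≠ 0) (a b : ℂ) :
    z ^ (-b) / z ^ (1 - a) = 1 / z ^ (1 + b - a) := by
  have h1 : z ^ (1 - a) ≠ 0 := by
    rw [Complex.cpow_def_of_ne_zero hz]; exact Complex.exp_ne_zero _
  have h2 : z ^ (1 + b - a) ≠ 0 := by
    rw [Complex.cpow_def_of_ne_zero hz]; exact Complex.exp_ne_zero _
  rw [div_eq_div_iff h1 h2, one_mul, ← Complex.cpow_add _ _ hz]
  congr 1; ring

/-- The summand of Lemma 12.1 WITHOUT the cut-off of `ϰ₁₃`: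
`Φ(l) = χ(l)·(log P₁)⁻¹(dl/P″₁)^{−β₆}log(dl/P″₁)·l^{β_j−1}`. For every `1 ≤ d`, its sum over
`1 ≤ l < P″₂/d` is the first displayed line `line020(d)` (the identity behind `sum121_eq_line020`,
which is the case `d > P″₁` where the cut-off is invisible). [cite: Zhang2022LandauSiegel, §12
proof of Lemma 12.1, p. 68] -/
private theorem sum_full_eq_line020 (hD : 3 ≤ D) (j : ℕ) {d : ℕ} (hd : 1 ≤ d) :
    ∑ l ∈ Finset.Ico 1 ⌈P2pp D / d⌉₊, χ (l : ZMod D) *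
        ((((Real.log (Skeleton.P1 D))⁻¹ : ℝ) : ℂ) *
          ((((d * l : ℕ) : ℝ) / P1pp D : ℝ) : ℂ) ^ (-beta6 D) *
            (Real.log (((d * l : ℕ) : ℝ) / P1pp D) : ℂ)) / (l : ℂ) ^ (1 - betaJ c' D j) =
      line020 c' χ j d := by
  have hP1pp : 0 < P1pp D := P1pp_pos hD
  have hd0 : (0 : ℝ) < d := by exact_mod_cast hd
  have hdP : 0 < (d : ℝ) / P1pp D := div_pos hd0 hP1pp
  set X : ℝ := P2pp D / d with hX
  set cd : ℂ := (((d : ℝ) / P1pp D : ℝ) : ℂ) with hcd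
  set u : ℝ := Real.log ((d : ℝ) / P1pp D) with hu
  set e : ℂ := 1 + beta6 D - betaJ c' D j with he
  have hterm : ∀ l ∈ Finset.Ico 1 ⌈X⌉₊,
      χ (l : ZMod D) * ((((Real.log (Skeleton.P1 D))⁻¹ : ℝ) : ℂ) *
          ((((d * l : ℕ) : ℝ) / P1pp D : ℝ) : ℂ) ^ (-beta6 D) *
            (Real.log (((d * l : ℕ) : ℝ) / P1pp D) : ℂ)) / (l : ℂ) ^ (1 - betaJ c' D j) =
        cd ^ (-beta6 D) * (u : ℂ) / (Real.log (Skeleton.P1 D) : ℂ) *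
            (χ (l : ZMod D) / (l : ℂ) ^ e) +
          cd ^ (-beta6 D) / (Real.log (Skeleton.P1 D) : ℂ) *
            (χ (l : ZMod D) * (Real.log l : ℂ) / (l : ℂ) ^ e) := by
    intro l hl
    rw [Finset.mem_Ico] at hl
    have hl1 : 1 ≤ l := hl.1
    have hl0 : (0 : ℝ) < l := by exact_mod_cast hl1
    have hlC : (l : ℂ) ≠ 0 := by exact_mod_cast (Nat.pos_iff_ne_zero.mp hl1)
    have hsplit : (((d * l : ℕ) : ℝ) / P1pp D : ℝ) = (d : ℝ) / P1pp D * l := by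
      push_cast; ring
    have hcpow : ((((d * l : ℕ) : ℝ) / P1pp D : ℝ) : ℂ) ^ (-beta6 D) =
        cd ^ (-beta6 D) * (l : ℂ) ^ (-beta6 D) := by
      rw [hsplit, Complex.ofReal_mul, Complex.mul_cpow_ofReal_nonneg hdP.le hl0.le,
        Complex.ofReal_natCast]
    have hlog : Real.log (((d * l : ℕ) : ℝ) / P1pp D) = u + Real.log l := by
      rw [hsplit, Real.log_mul hdP.ne' hl0.ne']
    rw [hcpow, hlog]
    have hq : (l : ℂ) ^ (-beta6 D) / (l : ℂ) ^ (1 - betaJ c' D j) = 1 / (l : ℂ) ^ e :=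
      cpow_neg_div_cpow_one_sub' hlC _ _
    have hinv : (((Real.log (Skeleton.P1 D))⁻¹ : ℝ) : ℂ) = ((Real.log (Skeleton.P1 D) : ℂ))⁻¹ :=
      Complex.ofReal_inv _
    rw [hinv]
    calc χ (l : ZMod D) * (((Real.log (Skeleton.P1 D) : ℂ))⁻¹ *
            (cd ^ (-beta6 D) * (l : ℂ) ^ (-beta6 D)) * ((u + Real.log l : ℝ) : ℂ)) /
            (l : ℂ) ^ (1 - betaJ c' D j)
        = χ (l : ZMod D) * ((Real.log (Skeleton.P1 D) : ℂ))⁻¹ * cd ^ (-beta6 D) *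
            ((u + Real.log l : ℝ) : ℂ) * ((l : ℂ) ^ (-beta6 D) / (l : ℂ) ^ (1 - betaJ c' D j)) := by
          ring
      _ = χ (l : ZMod D) * ((Real.log (Skeleton.P1 D) : ℂ))⁻¹ * cd ^ (-beta6 D) *
            ((u + Real.log l : ℝ) : ℂ) * (1 / (l : ℂ) ^ e) := by rw [hq]
      _ = _ := by push_cast; ring
  rw [Finset.sum_congr rfl hterm, Finset.sum_add_distrib, ← Finset.mul_sum, ← Finset.mul_sum,
    line020]

/-- For every `1 ≤ d`: the `l`-sum of Lemma 12.1 is the first displayed line MINUS its head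
`l ≤ P″₁/d` (where the cut-off `P″₁ < dl` of `ϰ₁₃` bites).
[cite: Zhang2022LandauSiegel, §12 proof of Lemma 12.1, p. 68] -/
private theorem sum121_eq_line020_sub_head (hD : 3 ≤ D) (j : ℕ) {d : ℕ} (hd : 1 ≤ d) :
    sum121 c' χ j d = line020 c' χ j d -
      ∑ l ∈ (Finset.Ico 1 ⌈P2pp D / d⌉₊).filter (fun l : ℕ => ¬ P1pp D / d < l),
        χ (l : ZMod D) * ((((Real.log (Skeleton.P1 D))⁻¹ : ℝ) : ℂ) *
          ((((d * l : ℕ) : ℝ) / P1pp D : ℝ) : ℂ) ^ (-beta6 D) *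
            (Real.log (((d * l : ℕ) : ℝ) / P1pp D) : ℂ)) / (l : ℂ) ^ (1 - betaJ c' D j) := by
  have hP1pp : 0 < P1pp D := P1pp_pos hD
  have hP2pp : 0 < P2pp D := P2pp_pos hD
  have hd0 : (0 : ℝ) < d := by exact_mod_cast hd
  rw [← sum_full_eq_line020 c' χ hD j hd, eq_sub_iff_add_eq,
    ← Finset.sum_filter_add_sum_filter_not (Finset.Ico 1 ⌈P2pp D / d⌉₊)
      (fun l : ℕ => P1pp D / d < l), add_left_inj]
  -- what remains: `sum121 = Σ_{l < X, P″₁/d < l} Φ(l)`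
  have hsub : Finset.Ico 1 ⌈P2pp D / d⌉₊ ⊆ Finset.Ico 1 ⌈P2pp D⌉₊ := by
    apply Finset.Ico_subset_Ico_right
    apply Nat.ceil_mono
    exact div_le_self hP2pp.le (by exact_mod_cast hd)
  have hzero : ∀ l ∈ Finset.Ico 1 ⌈P2pp D⌉₊, l ∉ Finset.Ico 1 ⌈P2pp D / d⌉₊ →
      χ (l : ZMod D) * vk13 D (d * l) / (l : ℂ) ^ (1 - betaJ c' D j) = 0 := by
    intro l hl hl'
    rw [Finset.mem_Ico] at hl
    rw [Finset.mem_Ico, not_and, not_lt] at hl'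
    have hXl : P2pp D / d ≤ l := Nat.ceil_le.mp (hl' hl.1)
    have hcond : ¬ (P1pp D < ((d * l : ℕ) : ℝ) ∧ ((d * l : ℕ) : ℝ) < P2pp D) := by
      rintro ⟨-, h2⟩
      rw [div_le_iff₀ hd0] at hXl
      push_cast at h2; nlinarith
    rw [vk13, if_neg hcond]; simp
  rw [Finset.sum_filter, sum121, ← Finset.sum_subset hsub hzero]
  refine Finset.sum_congr rfl ?_
  · intro l hl
    rw [Finset.mem_Ico] at hl
    have hlX : (l : ℝ) < P2pp D / d := Nat.lt_ceil.mp hl.2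
    by_cases hc : P1pp D / d < l
    · rw [if_pos hc]
      have hcond : P1pp D < ((d * l : ℕ) : ℝ) ∧ ((d * l : ℕ) : ℝ) < P2pp D := by
        push_cast
        constructor
        · rw [div_lt_iff₀ hd0] at hc; linarith
        · rw [lt_div_iff₀ hd0] at hlX; linarith
      rw [vk13, if_pos hcond]
    · rw [if_neg hc]
      have hcond : ¬ (P1pp D < ((d * l : ℕ) : ℝ) ∧ ((d * l : ℕ) : ℝ) < P2pp D) := by
        rintro ⟨h1, -⟩
        apply hc
        rw [div_lt_iff₀ hd0]
        push_cast at h1; linarith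
      rw [vk13, if_neg hcond]; simp

/-- The head is small: `‖Σ_{l ≤ Y} Φ(l)‖ ≤ (log P₁)⁻¹ log Y (1 + log Y)` for `Y = P″₁/d ≥ 1`
(`|Φ(l)| ≤ (log P₁)⁻¹ log(Y/l)/l`, harmonic sum). [cite: Zhang2022LandauSiegel, §12 proof of
Lemma 12.1, p. 68] -/
private theorem norm_head_le (hD : 3 ≤ D) {j : ℕ} (hj : (betaJ c' D j).re = 0) {d : ℕ}
    (hd : 1 ≤ d) (hdY : (d : ℝ) ≤ P1pp D) (hlogP1 : 0 < Real.log (Skeleton.P1 D)) :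
    ‖∑ l ∈ (Finset.Ico 1 ⌈P2pp D / d⌉₊).filter (fun l : ℕ => ¬ P1pp D / d < l),
        χ (l : ZMod D) * ((((Real.log (Skeleton.P1 D))⁻¹ : ℝ) : ℂ) *
          ((((d * l : ℕ) : ℝ) / P1pp D : ℝ) : ℂ) ^ (-beta6 D) *
            (Real.log (((d * l : ℕ) : ℝ) / P1pp D) : ℂ)) / (l : ℂ) ^ (1 - betaJ c' D j)‖ ≤
      (Real.log (Skeleton.P1 D))⁻¹ * Real.log (P1pp D / d) * (1 + Real.log (P1pp D / d)) := by
  have hP1pp : 0 < P1pp D := P1pp_pos hD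
  have hd0 : (0 : ℝ) < d := by exact_mod_cast hd
  set Y : ℝ := P1pp D / d with hY
  have hY1 : 1 ≤ Y := by rw [hY, le_div_iff₀ hd0, one_mul]; exact hdY
  have hY0 : 0 < Y := by linarith
  have hlogY : 0 ≤ Real.log Y := Real.log_nonneg hY1
  -- the filtered index set sits inside `[1, ⌊Y⌋]`
  have hsub : (Finset.Ico 1 ⌈P2pp D / d⌉₊).filter (fun l : ℕ => ¬ Y < l) ⊆
      Finset.Icc 1 ⌊Y⌋₊ := by
    intro l hl
    rw [Finset.mem_filter, Finset.mem_Ico, not_lt] at hl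
    rw [Finset.mem_Icc]
    exact ⟨hl.1.1, Nat.le_floor hl.2⟩
  -- termwise bound
  have hterm : ∀ l ∈ (Finset.Ico 1 ⌈P2pp D / d⌉₊).filter (fun l : ℕ => ¬ Y < l),
      ‖χ (l : ZMod D) * ((((Real.log (Skeleton.P1 D))⁻¹ : ℝ) : ℂ) *
          ((((d * l : ℕ) : ℝ) / P1pp D : ℝ) : ℂ) ^ (-beta6 D) *
            (Real.log (((d * l : ℕ) : ℝ) / P1pp D) : ℂ)) / (l : ℂ) ^ (1 - betaJ c' D j)‖ ≤
        (Real.log (Skeleton.P1 D))⁻¹ * Real.log Y * (1 / (l : ℝ)) := by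
    intro l hl
    rw [Finset.mem_filter, Finset.mem_Ico, not_lt] at hl
    have hl1 : 1 ≤ l := hl.1.1
    have hl0 : (0 : ℝ) < l := by exact_mod_cast hl1
    have hlY : (l : ℝ) ≤ Y := hl.2
    have hdl : 0 < ((d * l : ℕ) : ℝ) / P1pp D := by push_cast; positivity
    have hdl' : (((d * l : ℕ) : ℝ) / P1pp D : ℝ) = l / Y := by
      rw [hY]; push_cast; field_simp
    have hβ6re : (-beta6 D).re = 0 := by
      rw [Complex.neg_re]; simp [beta6]
    rw [norm_div, norm_mul, norm_mul, norm_mul, Complex.norm_real, Complex.norm_real,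
      Complex.norm_cpow_eq_rpow_re_of_pos hdl, hβ6re, Real.rpow_zero, mul_one,
      Complex.norm_natCast_cpow_of_pos (Nat.pos_iff_ne_zero.mp hl1 |> Nat.pos_of_ne_zero),
      Complex.sub_re, Complex.one_re, hj, sub_zero, Real.rpow_one, Real.norm_eq_abs,
      abs_of_pos (inv_pos.mpr hlogP1), Real.norm_eq_abs, hdl']
    have hχ : ‖χ (l : ZMod D)‖ ≤ 1 := DirichletCharacter.norm_le_one χ _
    have hlogabs : |Real.log (l / Y)| ≤ Real.log Y := by
      rw [Real.log_div hl0.ne' hY0.ne', abs_sub_comm, abs_of_nonneg (by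
        have := Real.log_le_log hl0 hlY; linarith)]
      have : 0 ≤ Real.log l := Real.log_nonneg (by exact_mod_cast hl1)
      linarith
    calc ‖χ (l : ZMod D)‖ * ((Real.log (Skeleton.P1 D))⁻¹ * |Real.log (l / Y)|) / (l : ℝ)
        ≤ 1 * ((Real.log (Skeleton.P1 D))⁻¹ * Real.log Y) / (l : ℝ) := by
          gcongr
      _ = (Real.log (Skeleton.P1 D))⁻¹ * Real.log Y * (1 / (l : ℝ)) := by ring
  -- the harmonic sum
  have hharm : ∑ l ∈ Finset.Icc 1 ⌊Y⌋₊, (1 / (l : ℝ)) ≤ 1 + Real.log Y := by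
    have h1 : ∑ l ∈ Finset.Icc 1 ⌊Y⌋₊, (1 / (l : ℝ)) =
        ∑ n ∈ Finset.range ⌊Y⌋₊, 1 / ((n + 1 : ℕ) : ℝ) := by
      have hIcc : Finset.Icc 1 ⌊Y⌋₊ = Finset.Ico 1 (⌊Y⌋₊ + 1) := by
        ext l; simp only [Finset.mem_Icc, Finset.mem_Ico]; omega
      rw [hIcc, Finset.sum_Ico_eq_sum_range, Nat.add_sub_cancel]
      refine Finset.sum_congr rfl fun n _ => ?_
      rw [add_comm]
    rw [h1]
    refine (Lemma82.sum_inv_le_one_add_log ⌊Y⌋₊).trans ?_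
    have hfl : (1 : ℝ) ≤ ⌊Y⌋₊ := by exact_mod_cast Nat.floor_pos.mpr hY1
    have : Real.log (⌊Y⌋₊ : ℝ) ≤ Real.log Y := Real.log_le_log (by linarith) (Nat.floor_le hY0.le)
    linarith
  calc ‖∑ l ∈ (Finset.Ico 1 ⌈P2pp D / d⌉₊).filter (fun l : ℕ => ¬ Y < l), _‖
      ≤ ∑ l ∈ (Finset.Ico 1 ⌈P2pp D / d⌉₊).filter (fun l : ℕ => ¬ Y < l), ‖_‖ := norm_sum_le _ _
    _ ≤ ∑ l ∈ (Finset.Ico 1 ⌈P2pp D / d⌉₊).filter (fun l : ℕ => ¬ Y < l),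
          (Real.log (Skeleton.P1 D))⁻¹ * Real.log Y * (1 / (l : ℝ)) := Finset.sum_le_sum hterm
    _ ≤ ∑ l ∈ Finset.Icc 1 ⌊Y⌋₊, (Real.log (Skeleton.P1 D))⁻¹ * Real.log Y * (1 / (l : ℝ)) :=
        Finset.sum_le_sum_of_subset_of_nonneg hsub fun l _ _ => by positivity
    _ = (Real.log (Skeleton.P1 D))⁻¹ * Real.log Y * ∑ l ∈ Finset.Icc 1 ⌊Y⌋₊, (1 / (l : ℝ)) := by
        rw [Finset.mul_sum]
    _ ≤ (Real.log (Skeleton.P1 D))⁻¹ * Real.log Y * (1 + Real.log Y) :=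
        mul_le_mul_of_nonneg_left hharm (by positivity)

end RangeTwo

/-! ### Clause (ii)′: the surviving weak form on `P″₁/T < d ≤ P″₁` -/

section RangeTwoMain

variable (c' : ℝ)

set_option maxHeartbeats 800000 in
-- one long assembly: above the default budget
/-- The weak form of clause (ii), from the closed form of the first line (hypothesis `h20` = the pow15 closed form
`line020_closed_form_pow15`; guard `‖L(1,χ)‖ ≤ 𝓛⁻¹⁵`). [cite: Zhang2022LandauSiegel, §12 Lemma 12.1, p. 68] -/
private theorem range_two_weak_of
    (h20 : ∃ C : ℝ, ForAllLarge fun D _ χ => ‖χ.LFunction 1‖ ≤ 1 / Real.log D ^ 15 →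
      ∀ j ∈ ({1, 2, 3} : Finset ℕ), ∀ d : ℕ, 1 ≤ d → (d : ℝ) < Skeleton.P2 D →
        ‖line020 c' χ j d -
            deriv χ.LFunction 1 * ((d / P1pp D : ℝ) : ℂ) ^ (-beta6 D) /
                (Real.log (Skeleton.P1 D) : ℂ) *
              (-1 + (beta6 D - betaJ c' D j) * (Real.log (d / P1pp D) : ℂ))‖ ≤
          C * (ell D ^ 15)⁻¹) :
    ∃ C : ℝ, ForAllLarge fun D _ χ => ‖χ.LFunction 1‖ ≤ 1 / Real.log D ^ 15 →
      ∀ j ∈ ({1, 2, 3} : Finset ℕ), ∀ d : ℕ, 1 ≤ d → P1pp D / bigT D < d → (d : ℝ) ≤ P1pp D →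
        ‖sum121 c' χ j d‖ ≤
          C * (‖deriv χ.LFunction 1‖ + Real.log D ^ (2.2 : ℝ)) / Real.log D ^ 9 := by
  obtain ⟨C₀, D₀, h⟩ := h20
  refine ⟨(4 + |C₀|) / 0.504, max D₀ ⌈Real.exp (20 + 32 * |c'|)⌉₊,
    fun D _ χ hD hq hp hA j hj d hd hdlow hdup => ?_⟩
  have hπ := Real.pi_pos
  have hc0 : 0 ≤ |c'| := abs_nonneg _
  have hC0 : 0 ≤ |C₀| := abs_nonneg _
  have hD₀ : D₀ ≤ D := le_trans (le_max_left _ _) hD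
  have hDexp : Real.exp (20 + 32 * |c'|) ≤ D :=
    le_trans (Nat.le_ceil _) (by exact_mod_cast le_trans (le_max_right _ _) hD)
  have hD0 : (0 : ℝ) < D := lt_of_lt_of_le (Real.exp_pos _) hDexp
  obtain ⟨L, hLdef⟩ : ∃ L : ℝ, L = Real.log D := ⟨_, rfl⟩
  have hL : 20 + 32 * |c'| ≤ L := by rw [hLdef]; exact (Real.le_log_iff_exp_le hD0).mpr hDexp
  have hL20 : 20 ≤ L := by linarith
  have hL1 : 1 ≤ L := by linarith
  have hL0 : 0 < L := by linarith
  have hell : ell D = L := hLdef.symm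
  have hDr : (21 : ℝ) ≤ D := by
    have := Real.log_le_sub_one_of_pos hD0; rw [← hLdef] at this; linarith
  have hD3 : 3 ≤ D := by exact_mod_cast (show (3 : ℝ) ≤ D by linarith)
  have hP : 0 < bigP D := Real.exp_pos _
  have hT : 0 < bigT D := Real.exp_pos _
  have hP1pp : 0 < P1pp D := P1pp_pos hD3
  have hd0 : (0 : ℝ) < d := by exact_mod_cast hd
  have hlogP1 : Real.log (Skeleton.P1 D) = 0.504 * L ^ 9 := by
    rw [Skeleton.P1, Real.log_rpow hP, bigP, Real.log_exp, hell]
  have hlogP1pos : 0 < Real.log (Skeleton.P1 D) := by rw [hlogP1]; positivity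
  -- powers of `L`
  have hL7 : (1.28e9 : ℝ) ≤ L ^ 7 := by
    have := pow_le_pow_left₀ (by norm_num) hL20 7; norm_num at this; linarith
  have hL2 : (400 : ℝ) ≤ L ^ 2 := by nlinarith
  have hLL2 : L ≤ L ^ 2 := by nlinarith
  have hL9low : 1.28e9 * L ^ 2 ≤ L ^ 9 := by
    rw [show L ^ 9 = L ^ 7 * L ^ 2 by ring]; exact mul_le_mul_of_nonneg_right hL7 (by positivity)
  have h11 : L ^ (1.1 : ℝ) ≤ L ^ 2 := by
    calc L ^ (1.1 : ℝ) ≤ L ^ ((2 : ℕ) : ℝ) := Real.rpow_le_rpow_of_exponent_le hL1 (by norm_num)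
      _ = L ^ 2 := Real.rpow_natCast L 2
  have h11nn : 0 ≤ L ^ (1.1 : ℝ) := Real.rpow_nonneg hL0.le _
  have h22 : L ^ (2.2 : ℝ) = L ^ (1.1 : ℝ) * L ^ (1.1 : ℝ) := by
    rw [← Real.rpow_add hL0]; norm_num
  have h1122 : L ^ (1.1 : ℝ) ≤ L ^ (2.2 : ℝ) := Real.rpow_le_rpow_of_exponent_le hL1 (by norm_num)
  have h22one : 1 ≤ L ^ (2.2 : ℝ) := Real.one_le_rpow hL1 (by norm_num)
  have hlogL : Real.log L ≤ L := by have := Real.log_le_sub_one_of_pos hL0; linarith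
  -- `d < P₂` (indeed `P″₁ < P₂`)
  have hdP2 : (d : ℝ) < Skeleton.P2 D := by
    have hlogP2 : Real.log (Skeleton.P2 D) = 0.5 * L ^ 9 - 10 * L ^ (1.1 : ℝ) := by
      rw [Skeleton.P2, Real.log_div (Real.rpow_pos_of_pos hP _).ne' (pow_pos hT 10).ne',
        Real.log_rpow hP, Real.log_pow, bigT, Real.log_exp, bigP, Real.log_exp, hell]
      push_cast; ring
    have hlogP1pp : Real.log (P1pp D) = 0.496 * L ^ 9 + L + 519 * Real.log L := by
      have ht0 : 0 < t0 D := by rw [t0, hell]; positivity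
      rw [P1pp, Real.log_mul (by positivity) ht0.ne', Real.log_mul (Real.rpow_pos_of_pos hP _).ne'
        hD0.ne', Real.log_rpow hP, bigP, Real.log_exp, t0, Real.log_pow, hell, ← hLdef]
      push_cast; ring
    have hP2pos : 0 < Skeleton.P2 D := by rw [Skeleton.P2]; positivity
    have hlt : Real.log (P1pp D) < Real.log (Skeleton.P2 D) := by
      rw [hlogP2, hlogP1pp]; linarith
    exact lt_of_le_of_lt hdup ((Real.log_lt_log_iff hP1pp hP2pos).mp hlt)
  -- the inputs
  have hclosed := h D χ hD₀ hq hp hA j hj d hd hdP2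
  rw [hell] at hclosed
  obtain ⟨hβjre, hβjn⟩ := betaJ_re_and_norm' c' (by linarith) hj
  rw [← hLdef] at hβjn
  have hdecomp := sum121_eq_line020_sub_head c' χ hD3 j hd
  have hhead := norm_head_le c' χ hD3 hβjre hd hdup hlogP1pos
  -- `Y = P″₁/d ∈ [1, T)`: `log Y < 𝓛^{1.1}`
  have hY1 : 1 ≤ P1pp D / d := by rw [le_div_iff₀ hd0, one_mul]; exact hdup
  have hYT : P1pp D / d < bigT D := by rw [div_lt_iff₀ hd0]; rw [div_lt_iff₀ hT] at hdlow; linarith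
  have hlogY0 : 0 ≤ Real.log (P1pp D / d) := Real.log_nonneg hY1
  have hlogY : Real.log (P1pp D / d) ≤ L ^ (1.1 : ℝ) := by
    have h1 : Real.log (P1pp D / d) < Real.log (bigT D) := Real.log_lt_log (by linarith) hYT
    rw [bigT, Real.log_exp, hell] at h1; exact h1.le
  -- the head: `≤ 2𝓛^{2.2}/(0.504𝓛⁹)`
  have hhead' : ‖∑ l ∈ (Finset.Ico 1 ⌈P2pp D / d⌉₊).filter (fun l : ℕ => ¬ P1pp D / d < l),
      χ (l : ZMod D) * ((((Real.log (Skeleton.P1 D))⁻¹ : ℝ) : ℂ) *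
        ((((d * l : ℕ) : ℝ) / P1pp D : ℝ) : ℂ) ^ (-beta6 D) *
          (Real.log (((d * l : ℕ) : ℝ) / P1pp D) : ℂ)) / (l : ℂ) ^ (1 - betaJ c' D j)‖ ≤
      2 * L ^ (2.2 : ℝ) / (0.504 * L ^ 9) := by
    refine hhead.trans ?_
    rw [hlogP1]
    have h1 : Real.log (P1pp D / d) * (1 + Real.log (P1pp D / d)) ≤ 2 * L ^ (2.2 : ℝ) := by
      calc Real.log (P1pp D / d) * (1 + Real.log (P1pp D / d))
          ≤ L ^ (1.1 : ℝ) * (1 + L ^ (1.1 : ℝ)) := by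
            exact mul_le_mul hlogY (by linarith) (by linarith) h11nn
        _ = L ^ (1.1 : ℝ) + L ^ (2.2 : ℝ) := by rw [h22]; ring
        _ ≤ 2 * L ^ (2.2 : ℝ) := by linarith
    rw [mul_assoc, show 2 * L ^ (2.2 : ℝ) / (0.504 * L ^ 9) = (0.504 * L ^ 9)⁻¹ * (2 * L ^ (2.2 : ℝ))
      by rw [div_eq_inv_mul]]
    exact mul_le_mul_of_nonneg_left h1 (by positivity)
  -- the main term: `≤ 2‖L′‖/(0.504𝓛⁹)`
  have hα : alpha D = π / L ^ 9 := by rw [alpha, bigP, Real.log_exp, hell]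
  have hβ6eq : beta6 D = ((3 / 2 * (π / L ^ 9) : ℝ) : ℂ) * I := by rw [beta6, hα]; push_cast; ring
  have hβ6re : (beta6 D).re = 0 := by rw [hβ6eq]; exact Lemma82.re_ofReal_mul_I _
  have hβ6n : ‖beta6 D‖ ≤ (3 + 5 * |c'|) * (π / L ^ 9) := by
    rw [hβ6eq, Lemma82.norm_ofReal_mul_I, abs_of_pos (by positivity)]
    have h0 : 0 ≤ π / L ^ 9 := by positivity
    nlinarith only [h0, hc0]
  have hδ : ‖beta6 D - betaJ c' D j‖ ≤ (6 + 10 * |c'|) * π / L ^ 9 := by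
    calc ‖beta6 D - betaJ c' D j‖ ≤ ‖beta6 D‖ + ‖betaJ c' D j‖ := norm_sub_le _ _
      _ ≤ (3 + 5 * |c'|) * (π / L ^ 9) + (3 + 5 * |c'|) * (π / L ^ 9) := add_le_add hβ6n hβjn
      _ = (6 + 10 * |c'|) * π / L ^ 9 := by ring
  have hδu : ‖beta6 D - betaJ c' D j‖ * |Real.log ((d : ℝ) / P1pp D)| ≤ 1 := by
    have hu : |Real.log ((d : ℝ) / P1pp D)| = Real.log (P1pp D / d) := by
      rw [show (d : ℝ) / P1pp D = (P1pp D / d)⁻¹ by rw [inv_div], Real.log_inv, abs_neg,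
        abs_of_nonneg hlogY0]
    rw [hu]
    have h1 : ‖beta6 D - betaJ c' D j‖ * Real.log (P1pp D / d) ≤
        (6 + 10 * |c'|) * π / L ^ 9 * L ^ 2 :=
      mul_le_mul hδ (hlogY.trans h11) hlogY0 (by positivity)
    have h2 : (6 + 10 * |c'|) * π / L ^ 9 * L ^ 2 ≤ 1 := by
      rw [div_mul_eq_mul_div, div_le_one (by positivity)]
      have hπ4 : π < 3.15 := Real.pi_lt_d2
      have hL7' : L ≤ L ^ 7 := by
        calc L = L ^ 1 := (pow_one _).symm
          _ ≤ L ^ 7 := pow_le_pow_right₀ hL1 (by norm_num)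
      have : (6 + 10 * |c'|) * π ≤ L := by nlinarith
      calc (6 + 10 * |c'|) * π * L ^ 2 ≤ L * L ^ 2 := by
            exact mul_le_mul_of_nonneg_right this (by positivity)
        _ ≤ L ^ 7 * L ^ 2 := mul_le_mul_of_nonneg_right hL7' (by positivity)
        _ = L ^ 9 := by ring
    linarith
  have hdP : 0 < (d : ℝ) / P1pp D := div_pos hd0 hP1pp
  have hmain : ‖deriv χ.LFunction 1 * (((d : ℝ) / P1pp D : ℝ) : ℂ) ^ (-beta6 D) /
      (Real.log (Skeleton.P1 D) : ℂ) *
        (-1 + (beta6 D - betaJ c' D j) * (Real.log ((d : ℝ) / P1pp D) : ℂ))‖ ≤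
      2 * ‖deriv χ.LFunction 1‖ / (0.504 * L ^ 9) := by
    have hcd : ‖(((d : ℝ) / P1pp D : ℝ) : ℂ) ^ (-beta6 D)‖ = 1 := by
      rw [Complex.norm_cpow_eq_rpow_re_of_pos hdP, Complex.neg_re, hβ6re, neg_zero, Real.rpow_zero]
    have hlP : ‖(Real.log (Skeleton.P1 D) : ℂ)‖ = 0.504 * L ^ 9 := by
      rw [Complex.norm_real, Real.norm_eq_abs, hlogP1, abs_of_pos (by positivity)]
    have hbr : ‖(-1 : ℂ) + (beta6 D - betaJ c' D j) * (Real.log ((d : ℝ) / P1pp D) : ℂ)‖ ≤ 2 := by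
      calc ‖(-1 : ℂ) + (beta6 D - betaJ c' D j) * (Real.log ((d : ℝ) / P1pp D) : ℂ)‖
          ≤ ‖(-1 : ℂ)‖ + ‖(beta6 D - betaJ c' D j) * (Real.log ((d : ℝ) / P1pp D) : ℂ)‖ :=
            norm_add_le _ _
        _ = 1 + ‖beta6 D - betaJ c' D j‖ * |Real.log ((d : ℝ) / P1pp D)| := by
            rw [norm_neg, norm_one, norm_mul, Complex.norm_real, Real.norm_eq_abs]
        _ ≤ 2 := by linarith
    rw [norm_mul, norm_div, norm_mul, hcd, hlP, mul_one]
    rw [show 2 * ‖deriv χ.LFunction 1‖ / (0.504 * L ^ 9) =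
      ‖deriv χ.LFunction 1‖ / (0.504 * L ^ 9) * 2 by ring]
    exact mul_le_mul_of_nonneg_left hbr (by positivity)
  -- assemble
  have hline : ‖line020 c' χ j d‖ ≤ 2 * ‖deriv χ.LFunction 1‖ / (0.504 * L ^ 9) + |C₀| * (L ^ 15)⁻¹ := by
    have htri := norm_le_norm_add_norm_sub' (line020 c' χ j d)
      (deriv χ.LFunction 1 * (((d : ℝ) / P1pp D : ℝ) : ℂ) ^ (-beta6 D) /
        (Real.log (Skeleton.P1 D) : ℂ) *
          (-1 + (beta6 D - betaJ c' D j) * (Real.log ((d : ℝ) / P1pp D) : ℂ)))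
    have hC : C₀ * (L ^ 15)⁻¹ ≤ |C₀| * (L ^ 15)⁻¹ :=
      mul_le_mul_of_nonneg_right (le_abs_self _) (by positivity)
    linarith
  have hgoal : ‖sum121 c' χ j d‖ ≤ 2 * ‖deriv χ.LFunction 1‖ / (0.504 * L ^ 9) +
      |C₀| * (L ^ 15)⁻¹ + 2 * L ^ (2.2 : ℝ) / (0.504 * L ^ 9) := by
    rw [hdecomp]
    exact (norm_sub_le _ _).trans (add_le_add hline hhead')
  refine hgoal.trans ?_
  rw [← hLdef]
  -- `|C₀|/𝓛¹⁵ ≤ |C₀|𝓛^{2.2}/(0.504𝓛⁹)`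
  have hL6 : (1 : ℝ) ≤ 0.504 * L ^ 6 := by nlinarith [pow_le_pow_left₀ (by norm_num : (0:ℝ) ≤ 20) hL20 6]
  have hmid : |C₀| * (L ^ 15)⁻¹ ≤ |C₀| * L ^ (2.2 : ℝ) / (0.504 * L ^ 9) := by
    rw [div_eq_mul_inv, mul_assoc]
    refine mul_le_mul_of_nonneg_left ?_ hC0
    rw [← div_eq_mul_inv, le_div_iff₀ (by positivity)]
    calc (L ^ 15)⁻¹ * (0.504 * L ^ 9) = 0.504 / L ^ 6 := by field_simp
      _ ≤ 1 := by
          rw [div_le_one (by positivity)]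
          nlinarith [pow_le_pow_left₀ (by norm_num : (0:ℝ) ≤ 20) hL20 6]
      _ ≤ L ^ (2.2 : ℝ) := h22one
  have hnn : 0 ≤ ‖deriv χ.LFunction 1‖ := norm_nonneg _
  calc 2 * ‖deriv χ.LFunction 1‖ / (0.504 * L ^ 9) + |C₀| * (L ^ 15)⁻¹ +
        2 * L ^ (2.2 : ℝ) / (0.504 * L ^ 9)
      ≤ 2 * ‖deriv χ.LFunction 1‖ / (0.504 * L ^ 9) + |C₀| * L ^ (2.2 : ℝ) / (0.504 * L ^ 9) +
          2 * L ^ (2.2 : ℝ) / (0.504 * L ^ 9) := by linarith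
    _ = (2 * ‖deriv χ.LFunction 1‖ + (|C₀| + 2) * L ^ (2.2 : ℝ)) / 0.504 / L ^ 9 := by
        field_simp; ring
    _ ≤ ((4 + |C₀|) * (‖deriv χ.LFunction 1‖ + L ^ (2.2 : ℝ))) / 0.504 / L ^ 9 := by
        gcongr
        nlinarith
    _ = (4 + |C₀|) / 0.504 * (‖deriv χ.LFunction 1‖ + L ^ (2.2 : ℝ)) / L ^ 9 := by ring

/-- **Lemma 12.1 clause (ii), SURVIVING WEAK FORM (ledger `G-d35-1`)**: for every real `c′`, under
(A), for all large `D`, `j ∈ {1,2,3}` and `P″₁/T < d ≤ P″₁`: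
`‖Σ_l χ(l)ϰ₁₃(dl)l^{β_j−1}‖ ≤ C·(|L′(1,χ)| + 𝓛^{2.2})/𝓛⁹`.
The printed claim is `≪ α₁` (`= α𝓛 = π𝓛⁻⁸` in the banked reading, `α log T = π𝓛^{−7.9}` in the
reading of record); at `d = ⌊P″₁⌋` the sum equals `−L′(1,χ)(d/P″₁)^{−β₆}/log P₁ + O(𝓛⁻¹⁵)`
(`line020_closed_form` minus an empty head), so the printed strength needs `L′(1,χ) ≪ 𝓛` (resp.
`𝓛^{1.1}`) UNDER (A) — not in print, FACT-LIST or tree; what IS derivable is this bound (closed form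
of the first line for all `d < P₂`, `Typed.Sec12B.line020_closed_form`, minus the head `l ≤ P″₁/d`,
bounded by `(log P₁)⁻¹log Y(1 + log Y)`, `Y = P″₁/d < T`). [TWIN UNDER THE MINIMUM PREMISE `‖L(1,χ)‖ ≤ 𝓛⁻¹⁵` of `sum121_range_two_weak`, proof verbatim over `line020_closed_form_pow15`.] With the tree's trivial
`|L′(1,χ)| ≤ 4e^{9/2}𝓛²` this is `O(𝓛^{−6.8}) = O(α𝓛^{2.2})`, which keeps the range's contribution to
`S_j(𝐚₁₅,𝐚₂₂)` (§12 p. 73) at `o(α)` with room. [cite: Zhang2022LandauSiegel, §12 Lemma 12.1, p. 68] -/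
theorem sum121_range_two_weak_pow15 : ∃ C : ℝ, ForAllLarge fun D _ χ => ‖χ.LFunction 1‖ ≤ 1 / Real.log D ^ 15 →
    ∀ j ∈ ({1, 2, 3} : Finset ℕ), ∀ d : ℕ, 1 ≤ d → P1pp D / bigT D < d → (d : ℝ) ≤ P1pp D →
      ‖sum121 c' χ j d‖ ≤
        C * (‖deriv χ.LFunction 1‖ + Real.log D ^ (2.2 : ℝ)) / Real.log D ^ 9 :=
  range_two_weak_of c' (line020_closed_form_pow15 c')

/-- [TWIN UNDER `‖L(1,χ)‖ ≤ 𝓛⁻¹⁵` of `sum121_range_two_weak'`.] The same with the tree's unconditional bound `|L′(1,χ)| ≤ 2e^{9/2}(1+𝓛)𝓛 ≤ 4e^{9/2}𝓛²`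
(`Lemma31.norm_deriv_LFunction_le_near_one`): on `P″₁/T < d ≤ P″₁`,
`‖Σ_l χ(l)ϰ₁₃(dl)l^{β_j−1}‖ ≤ C·𝓛^{2.2}/𝓛⁹` (vs. the printed `≪ α₁`). [cite: Zhang2022LandauSiegel,
§12 Lemma 12.1, p. 68] -/
theorem sum121_range_two_weak_pow15' : ∃ C : ℝ, ForAllLarge fun D _ χ => ‖χ.LFunction 1‖ ≤ 1 / Real.log D ^ 15 →
    ∀ j ∈ ({1, 2, 3} : Finset ℕ), ∀ d : ℕ, 1 ≤ d → P1pp D / bigT D < d → (d : ℝ) ≤ P1pp D →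
      ‖sum121 c' χ j d‖ ≤ C * Real.log D ^ (2.2 : ℝ) / Real.log D ^ 9 := by
  obtain ⟨C, D₀, h⟩ := sum121_range_two_weak_pow15 c'
  refine ⟨|C| * (4 * Real.exp (9 / 2) + 1), max D₀ ⌈Real.exp 3⌉₊,
    fun D _ χ hD hq hp hA j hj d hd hdlow hdup => ?_⟩
  have hD₀ : D₀ ≤ D := le_trans (le_max_left _ _) hD
  have hDexp : Real.exp 3 ≤ D :=
    le_trans (Nat.le_ceil _) (by exact_mod_cast le_trans (le_max_right _ _) hD)
  have hD0 : (0 : ℝ) < D := lt_of_lt_of_le (Real.exp_pos _) hDexp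
  have hL3 : 3 ≤ Real.log D := (Real.le_log_iff_exp_le hD0).mpr hDexp
  have hL1 : 1 ≤ Real.log D := by linarith
  have hL0 : 0 < Real.log D := by linarith
  have key := h D χ hD₀ hq hp hA j hj d hd hdlow hdup
  have hderiv : ‖deriv χ.LFunction 1‖ ≤ 4 * Real.exp (9 / 2) * Real.log D ^ (2.2 : ℝ) := by
    have hw : ‖(1 : ℂ) - 1‖ ≤ 1 / Real.log D := by
      rw [sub_self, norm_zero]; positivity
    refine (Lemma31.norm_deriv_LFunction_le_near_one χ hL3 hp hw).trans ?_
    have h2 : Real.log D ^ 2 ≤ Real.log D ^ (2.2 : ℝ) := by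
      calc Real.log D ^ 2 = Real.log D ^ ((2 : ℕ) : ℝ) := (Real.rpow_natCast _ 2).symm
        _ ≤ Real.log D ^ (2.2 : ℝ) := Real.rpow_le_rpow_of_exponent_le hL1 (by norm_num)
    have h1 : (1 + Real.log D) * Real.log D ≤ 2 * Real.log D ^ 2 := by nlinarith
    have h0 : 0 ≤ 2 * Real.exp (9 / 2) := by positivity
    nlinarith
  have hC : C ≤ |C| := le_abs_self C
  have h22 : 0 ≤ Real.log D ^ (2.2 : ℝ) := Real.rpow_nonneg hL0.le _
  calc ‖sum121 c' χ j d‖ ≤ C * (‖deriv χ.LFunction 1‖ + Real.log D ^ (2.2 : ℝ)) / Real.log D ^ 9 :=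
        key
    _ ≤ |C| * (‖deriv χ.LFunction 1‖ + Real.log D ^ (2.2 : ℝ)) / Real.log D ^ 9 := by
        gcongr
    _ ≤ |C| * ((4 * Real.exp (9 / 2) + 1) * Real.log D ^ (2.2 : ℝ)) / Real.log D ^ 9 := by
        gcongr; linarith
    _ = |C| * (4 * Real.exp (9 / 2) + 1) * Real.log D ^ (2.2 : ℝ) / Real.log D ^ 9 := by ring

end RangeTwoMain

end Literature.NumberTheory.LFunctions.Zhang2022.Typed.Sec12B

end
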